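import Literature.AlgebraicGeometry.Modules.RankOneCocycle
import Literature.AlgebraicGeometry.Modules.PullbackUnitSections
import HarnessLib

/-!
# The evaluation morphism at a section and the determinant of an evaluation family in frames (definitions)

Topic `AlgebraicGeometry/Modules`; namespace `Literature.AlgebraicGeometry.Modules`.  DEFINITIONS (four `def`s with
bodies + unfolding lemmas); no theorem of substance, no instance, no notation, no named fact, no `sorry`.  Generic
`𝒪_X`-module infrastructure (director g12 RULING s243 (a): library definitions for the F-9 road Q2; the theorems —
transformation law under change of frames, base change, non-vanishing locus — are the sequel PROOF file
`Modules/DeterminantSectionOfSections`).  Cell `hodgecm-mathlib` (D-0151), F-DAG F-9 (9b) row (G1); count-neutral: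
HC_CM is proved only modulo the 7 printed citations until rung 0 closes — nothing here bears on a summit statement.

[MumfordFogartyKirwan1994] Ch. 3 §1 (p. 68): for `n + 1` points `x^{(α₀)}, …, x^{(α_n)}` of `𝐏ⁿ` with homogeneous
coordinates `X_i^{(α)}`, «`D_{α₀,…,α_n} = det [X_i^{(α_j)}]` is a section of `L_{α₀} ⊗ ⋯ ⊗ L_{α_n}`»; Ch. 7 §3 Prop. 7.7
(p. 138) uses these determinants for the torsion points of the universal abelian scheme.  INTRINSICALLY (no projective
frame chosen): for a morphism `f : X → T` with a section `x` (`x ≫ f = 𝟙`) and an `𝒪_X`-module `L`, the EVALUATION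
`ev_x : f_*L → x^*L` (§1); for an `𝒪_T`-module `E` with a frame `e` of size `n` and `n` morphisms `ψ_j : E → L_j` into
modules with rank-one frames `g_j`, the EVALUATION MATRIX `A_{a j} = ` the coefficient of `ψ_j(b_a)` in `g_j` and its
determinant `det A ∈ Γ(T, V)` (§2: MFK's `D_α` read in frames, the frame of `E` absorbing `ℙ(E) ≅ 𝐏ⁿ`; [Hartshorne1977]
II Ex. 5.16: `det` of a morphism of locally free sheaves of the same rank is a section of `(det E)⁻¹ ⊗ det E′`), and the
same read in FRAME SYSTEMS at every point `t` (§3).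

* §1 `evalAtSection f x hx L : (pushforward f).obj L ⟶ (pullback x).obj L` — `f_* η_x` followed by
  `f_* x_* ≅ (x ≫ f)_* = (𝟙 T)_* ≅ 𝟭` (Mathlib `pushforwardComp`, `pushforwardCongr`, `pushforwardId`);
  `evalAtSection_app`: on sections over `V` it is `b ↦ η_x(b)` (★ `unitSection`) transported along `x⁻¹f⁻¹V = V`.
* §2 `evalMatrix ψ e ε k g ι k' : Matrix (Fin n) (Fin n) Γ(X, V)` and `evalDet … : Γ(X, V)` (its determinant), for a
  frame `e : 𝒪^I ≅ E|_U` enumerated by `ε : I ≃ Fin n`, rank-one frames `g j : 𝒪^{I′ j} ≅ L_j|_{U′ j}` with chosen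
  index `ι j`, over an open `V` below all of them (★ `coord`).
* §3 `FrameSystem.evalDet ψ F hF G hG W hW hW' t : Γ(X, W t)` — the determinant at the point `t` in the frame systems
  `F` (rank `n`) and `G j` (rank one, index ★ `FrameSystem.idx`), over ANY point-indexed opens `W t ≤ U_t ⊓ ⋂_j U′_{j,t}`
  (the consumer's common refinement); the point-indexed coefficient family of the (9b) road (★ `CocycleSections`-currency).

## References
* [MumfordFogartyKirwan1994] D. Mumford, J. Fogarty, F. Kirwan, *Geometric Invariant Theory*, 3rd ed. (1994), Ch. 3 §1
  Definition 3.3 and Proposition 3.1 (p. 68); Ch. 7 §3 Prop. 7.7 (p. 138).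
* [Hartshorne1977] R. Hartshorne, *Algebraic Geometry* (1977), II §5 (p. 110), II Ex. 5.16.
-/

noncomputable section

open CategoryTheory AlgebraicGeometry Opposite TopologicalSpace Limits

namespace Literature.AlgebraicGeometry.Modules

open Literature.AlgebraicGeometry.Motives

universe u

/-! ### §1 Evaluation of `f_*L` at a section `x` of `f` -/

section Eval

variable {X T : Scheme.{u}} (f : X ⟶ T) (x : T ⟶ X) (hx : x ≫ f = 𝟙 T) (L : X.Modules)

include hx in
/-- `V = x⁻¹(f⁻¹(V))` for a section `x` of `f`. [cite: Hartshorne1977, II §5 (p. 110)] -/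
theorem eq_preimage_preimage_of_comp_eq_id (V : T.Opens) : V = x ⁻¹ᵁ (f ⁻¹ᵁ V) := by
  rw [← Scheme.Hom.comp_preimage, hx]
  rfl

/-- **The evaluation morphism `ev_x : f_*L → x^*L` at a section `x` of `f : X → T`** (`x ≫ f = 𝟙_T`): `f_*` of the
unit `η_x : L → x_* x^* L`, followed by `f_* x_* ≅ (x ≫ f)_* = (𝟙_T)_* ≅ 𝟭`.  For `E = f_*L` of rank `n + 1` and the
embedding `X ↪ 𝐏(E)`, `ev_x` is the rank-one quotient of `E` defining the `T`-point `x` of `𝐏(E)` (MFK's homogeneous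
coordinates `X_i^{(α)}` of a marked point, without a chosen frame).
[cite: Hartshorne1977, II §5 (p. 110)] [cite: MumfordFogartyKirwan1994, Ch. 3 §1 Definition 3.3 (p. 68)] -/
def evalAtSection : (Scheme.Modules.pushforward f).obj L ⟶ (Scheme.Modules.pullback x).obj L :=
  (Scheme.Modules.pushforward f).map ((Scheme.Modules.pullbackPushforwardAdjunction x).unit.app L) ≫
    (Scheme.Modules.pushforwardComp x f).hom.app _ ≫ (Scheme.Modules.pushforwardCongr hx).hom.app _ ≫
      (Scheme.Modules.pushforwardId T).hom.app _

/-- **`ev_x` on sections**: a section `b ∈ Γ(f_*L, V) = Γ(L, f⁻¹V)` goes to its pull-back `η_x(b) ∈ Γ(x^*L, x⁻¹f⁻¹V)`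
(★ `unitSection`), transported along `x⁻¹f⁻¹V = V`. [cite: Hartshorne1977, II §5 (p. 110)] -/
theorem evalAtSection_app (V : T.Opens) (b : Γ(L, f ⁻¹ᵁ V)) :
    (evalAtSection f x hx L).app V (show Γ((Scheme.Modules.pushforward f).obj L, V) from b) =
      ((Scheme.Modules.pullback x).obj L).presheaf.map
        (eqToHom (eq_preimage_preimage_of_comp_eq_id f x hx V)).op (unitSection x L (f ⁻¹ᵁ V) b) := by
  simp only [evalAtSection, Scheme.Modules.Hom.comp_app, CategoryTheory.comp_apply,
    Scheme.Modules.pushforward_map_app, Scheme.Modules.pushforwardCongr_hom_app_app]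
  rfl

end Eval

/-! ### §2 The evaluation matrix and its determinant in frames -/

section Frames

variable {X : Scheme.{u}} {E : X.Modules} {n : ℕ} {L : Fin n → X.Modules} (ψ : ∀ j, E ⟶ L j)
  {U V : X.Opens} {I : Type u} (e : SheafOfModules.free I ≅ E.over U) (ε : I ≃ Fin n) (k : V ⟶ U)
  {U' : Fin n → X.Opens} {I' : Fin n → Type u} (g : ∀ j, SheafOfModules.free (I' j) ≅ (L j).over (U' j))
  (ι : ∀ j, I' j) (k' : ∀ j, V ⟶ U' j)

/-- **The EVALUATION MATRIX** of the family `ψ_j : E → L_j` (`j < n`) in the frame `e` of `E|_U` (basis sections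
`b_i`, enumerated by `ε : I ≃ Fin n`) and the rank-one frames `g_j` of `L_j|_{U′_j}` (index `ι j`), over an open `V`
below `U` and the `U′_j`: `A_{a j} =` the coefficient in `g_j` of `ψ_j(b_{ε⁻¹ a}|_V)` (★ `coord`).  For `E = f_*L`,
`L_j = x_j^*L`, `ψ_j = ev_{x_j}` this is MFK's matrix `[X_i^{(α_j)}]` of homogeneous coordinates of `n` marked points
read in a frame. [cite: MumfordFogartyKirwan1994, Ch. 3 §1 Definition 3.3 (p. 68)] [cite: Hartshorne1977, II Ex. 5.16] -/
def evalMatrix : Matrix (Fin n) (Fin n) Γ(X, V) :=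
  Matrix.of fun a j ↦ coord (g j) (k' j) ((ψ j).app V (E.presheaf.map k.op (basisSection e (ε.symm a)))) (ι j)

/-- Entries of the evaluation matrix. [cite: MumfordFogartyKirwan1994, Ch. 3 §1 Definition 3.3 (p. 68)] -/
theorem evalMatrix_apply (a j : Fin n) :
    evalMatrix ψ e ε k g ι k' a j =
      coord (g j) (k' j) ((ψ j).app V (E.presheaf.map k.op (basisSection e (ε.symm a)))) (ι j) := rfl

/-- **The EVALUATION DETERMINANT** `det A ∈ Γ(X, V)` of the family `ψ_j : E → L_j` in the frames `(e, g)` — MFK's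
`D_α = det [X_i^{(α_j)}]` read in frames; Hartshorne II Ex. 5.16: the determinant of a morphism between locally free
modules of the same rank, a section of `(det E)⁻¹ ⊗ ⨂_j L_j` written in the trivialisations.
[cite: MumfordFogartyKirwan1994, Ch. 3 §1 Definition 3.3 (p. 68)] [cite: Hartshorne1977, II Ex. 5.16] -/
def evalDet : Γ(X, V) :=
  (evalMatrix ψ e ε k g ι k').det

/-- Unfolding `evalDet`. [cite: Hartshorne1977, II Ex. 5.16] -/
theorem evalDet_eq_det : evalDet ψ e ε k g ι k' = (evalMatrix ψ e ε k g ι k').det := rfl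

end Frames

/-! ### §3 The same in frame systems, at every point -/

namespace FrameSystem

variable {X : Scheme.{u}} {E : X.Modules} {n : ℕ} {L : Fin n → X.Modules} (ψ : ∀ j, E ⟶ L j)
  (F : FrameSystem E) (hF : ∀ t, F.rank t = n) (G : ∀ j, FrameSystem (L j)) (hG : ∀ j t, (G j).rank t = 1)
  (W : X → X.Opens) (hW : ∀ t, W t ≤ F.U t) (hW' : ∀ j t, W t ≤ (G j).U t)

/-- **The evaluation determinant at the point `t` in frame systems** `F` of `E` (constant rank `n`, frames enumerated
by `F.enum` and `hF`) and `G j` of `L_j` (rank one, index ★ `FrameSystem.idx`), read over any point-indexed family of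
opens `W t` below `U_t` and the `U′_{j,t}` (the consumer's common refinement): the coefficient family
`t ↦ det A_t ∈ Γ(X, W t)` of MFK's `D_α` in the ★ `CocycleSections` currency.
[cite: MumfordFogartyKirwan1994, Ch. 3 §1 Definition 3.3 (p. 68)] [cite: Hartshorne1977, II Ex. 5.16] -/
def evalDet (t : X) : Γ(X, W t) :=
  Modules.evalDet ψ (F.frame t) ((F.enum t).trans (finCongr (hF t))) (homOfLE (hW t))
    (fun j ↦ (G j).frame t) (fun j ↦ (G j).idx (hG j) t) (fun j ↦ homOfLE (hW' j t))

/-- Unfolding `FrameSystem.evalDet`. [cite: Hartshorne1977, II Ex. 5.16] -/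
theorem evalDet_eq (t : X) :
    evalDet ψ F hF G hG W hW hW' t =
      Modules.evalDet ψ (F.frame t) ((F.enum t).trans (finCongr (hF t))) (homOfLE (hW t))
        (fun j ↦ (G j).frame t) (fun j ↦ (G j).idx (hG j) t) (fun j ↦ homOfLE (hW' j t)) := rfl

end FrameSystem

end Literature.AlgebraicGeometry.Modules

end
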